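import Summits.QuantumFields.YangMills.Theorems.PencilRigidityDiagonalMirrorRPRStubRpClosureDefs
import Literature.MathematicalPhysics.QuantumFieldTheory.TiltedTorusSwapRP

/-!
# Stub `stub_fortyFiveSwapRP` of the line `parity-bridge-cold-traces` (crux `stmt-QuantumFields-10604`)

Routes `PencilRigidity` / `MirrorModularBoosts` of `YangMills`, crux `DiagonalMirrorRPR`
(`Summit.QuantumFields.YangMills.Theses.MirrorModularBoosts.DiagonalMirrorRPR`, shared verbatim with
`…Theses.PencilRigidity.DiagonalMirrorRPR`), line `parity-bridge-cold-traces`, stub `stub_fortyFiveSwapRP` (S1).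
The vocabulary of the line (box tori `TSite … texp`, the 45° cover `swapSite`, `swapEdge`, `swapConfig`,
`posEdges`, the statement `CoverSwapRPAt`) is imported from `…Theorems.PencilRigidityDiagonalMirrorRPRStubRpClosureDefs`
(verbatim the registered skeleton's, same namespace), so the registered stub signature elaborates unchanged.

**What is proved (`stub_fortyFiveSwapRP`).** Exact swap reflection positivity of Wilson's lattice gauge
measure on the Fröhlich–Israel–Lieb–Simon 45° torus `T̃_N = ℤ⁴/⟨N(e₀+e₁), N(e₀−e₁), Ne₂, Ne₃⟩`, written in
the chart `(u, w, y, z) = (x₀ − x₁, x₁, x₂, x₃)` as `ℤ_{2N} × ℤ_N × ℤ_N × ℤ_N` with steps `e₀ = (1,0,0,0)`,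
`e₁ = (−1,1,0,0)`, `e₂`, `e₃`: for a compact group `G`, a continuous unitary matrix representation `ρ`,
`β ≥ 0`, `N ≥ 2` and every bounded measurable `F` depending only on the links of the closed half
`0 ≤ u ≤ N` (`posEdges N`), `⟨conj (F ∘ θ^*) · F⟩_β` (`texp ρ β true`) is real and `≥ 0`, where
`θ (u,w,y,z) = (−u, w + u, y, z)` is the swap `x₀ ↔ x₁` (it fixes the two mirror layers `u = 0`, `u = N`
pointwise and exchanges `e₀ ↔ e₁`). `N = 1` is false (both layers are mirrors, the half is everything).

**Proof.** The un-normalised integral `∫ conj F(θ^*U) F(U) e^{β · action(U)} dHaar(U)` is a real non-negative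
complex number by the Literature theorem `TiltedTorusRP.integral_conj_swap_mul_nonneg`
(`Literature/MathematicalPhysics/QuantumFieldTheory/TiltedTorusSwapRP.lean`: FILS 1978 Thm. 2.1 on the tilted
torus, reduced to the tree engine `LatticeRP.integral_mul_conj_mul_exp_nonneg_of_shared` with shared block the
`e₂,e₃`-links of the two mirror layers, no crossing links, positive block the other links of the closed half,
and the `(0,1)`-plaquettes based on the layers cut along their diagonal `U_p = P₊ (P₊ ∘ θ^*)⁻¹`, a Gram kernel
by unitarity), whose geometric data are parameters with defining equations — instantiated here with
`tstep true`, `swapSite`, `swapEdge`, `swapConfig`, `tplaq true`, `taction ρ true`, `tweight ρ β true`, `thaar`,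
`posEdges` by `rfl`. Dividing by the real number `Z = tZ ≥ 0` keeps `Re ≥ 0` and `Im = 0`.

References: J. Fröhlich, R. Israel, E. Lieb, B. Simon, Comm. Math. Phys. 62 (1978) 1, Thm. 2.1, and
J. Stat. Phys. 22 (1980) 297, §3 (45° lattices); K. Osterwalder, E. Seiler, Ann. Phys. 110 (1978) 440, §2.
-/

set_option autoImplicit false

noncomputable section

open scoped ComplexConjugate ComplexOrder
open MeasureTheory
open Literature.MathematicalPhysics.QuantumFieldTheory

namespace Summit.QuantumFields.YangMills.Cruxes.DiagonalMirrorRPR.ParityBridgeColdTraces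

/-- **S1 (M).** Exact swap-RP of Wilson's measure on the 45° torus `T̃_N = ℤ_{2N} × ℤ_N × ℤ_N²` (sheared chart),
every compact `G`, continuous unitary `ρ`, `β ≥ 0`, `N ≥ 2`, observables of the CLOSED half `0 ≤ u ≤ N`.
Proof: the un-normalised integral `∫ conj F(θ^*U) F(U) e^{β·action} dHaar` is a real non-negative complex number by
the Literature theorem `TiltedTorusRP.integral_conj_swap_mul_nonneg` (FILS 1978 Thm. 2.1 on the tilted torus,
reduced there to the tree engine `LatticeRP.integral_mul_conj_mul_exp_nonneg_of_shared`), instantiated with the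
line's vocabulary by `rfl`; dividing by the real number `Z ≥ 0` keeps the real part `≥ 0` and the imaginary part `0`. -/
theorem stub_fortyFiveSwapRP :
    ∀ (G : Type) [Group G] [TopologicalSpace G] [IsTopologicalGroup G] [CompactSpace G]
      [MeasurableSpace G] [BorelSpace G] (Nc : ℕ) (ρ : G →* Matrix (Fin Nc) (Fin Nc) ℂ),
      Continuous ρ → (∀ g, ρ g ∈ Matrix.unitaryGroup (Fin Nc) ℂ) →
        ∀ (β : ℝ), 0 ≤ β → ∀ (N : ℕ) [NeZero N], 2 ≤ N → CoverSwapRPAt ρ β N := by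
  intro G _ _ _ _ _ _ Nc ρ hρ hu β hβ N _ hN F hF hFb hFdep
  obtain ⟨C, hC⟩ := hFb
  have hI : 0 ≤ ∫ U, conj (F (swapConfig U)) * F U * ((tweight ρ β true U : ℝ) : ℂ)
      ∂(thaar (2 * N) N N : Measure (TConfig (2 * N) N N G)) :=
    TiltedTorusRP.integral_conj_swap_mul_nonneg ρ hρ hu hN (tstep true)
      (by funext i; fin_cases i <;> simp [tstep]) swapSite rfl swapEdge rfl swapConfig rfl (tplaq true) rfl
      (taction ρ true) rfl hβ (tweight ρ β true) rfl (thaar (2 * N) N N) rfl (posEdges N) (fun _ => Iff.rfl)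
      hF hC hFdep
  have hZ : 0 ≤ tZ ρ (2 * N) N N β true := integral_nonneg fun U => (Real.exp_pos _).le
  obtain ⟨hre, him⟩ := Complex.nonneg_iff.1 hI
  unfold texp
  rw [Complex.div_ofReal_re, Complex.div_ofReal_im]
  exact ⟨div_nonneg hre hZ, by rw [← him, zero_div]⟩

end Summit.QuantumFields.YangMills.Cruxes.DiagonalMirrorRPR.ParityBridgeColdTraces

end
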